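import Summits.ResolutionOfSingularities.ResolutionOfSingularities.Theorems.AdaptedChartHensel
import HarnessLib

/-!
# AdaptedChartHensel2 — decomp-res node «HenselLadder» PART VI ((K-H), lens-1 g22 ADDENDUM), tree companion

Content VERBATIM from PART VI of the decomp-res lens-1 g22 node `HOME/decomp-res-lens-1/g22/HenselLadder.lean`
(HOME = run/shared/lean/pub/decomp-res; ADDENDUM-g22.md), re-namespaced `…Theorems.AdaptedChartHensel` (one namespace
across the three companion files `AdaptedChartHensel`, `AdaptedChartHensel2`, `AdaptedChartHensel3`, split for the
400-line cap), typed against the LANDED `Theorems.HenselKeyChainLU` (p803393), `Literature…KollarEtaleCoordinates`,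
`Literature.RingTheory.Flat` (via the tree) and Mathlib's standard-étale API; nothing inlined; a pure addition (no
existing file touched).  Landing target: `Summits/ResolutionOfSingularities/ResolutionOfSingularities/Theorems/AdaptedChartHensel2.lean`
(`--kind proof --supports stmt-ResolutionOfSingularities-0641`, HELPER file of the host route `Valuative`).

WINDOW g23 item (K-H) (CRITIC-LEDGER row 167): THEOREM H (⟸) IN KERNEL — every rank-one place with residue field `k`
that admits a (value-)ADAPTED REGULAR CHART on some finite-type model lies in the Hensel cell
`HenselKeyChainTopBelow k O`, MODULO THEOREM D typed as the hypothesis `TheoremD k` (window: «D admissible as a TYPED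
hypothesis»; THEOREM D = g21 ADDENDUM, row 163a, to be landed as item (K-D) against `TheoremD k`).  The étale local
structure (EGA IV 18.4.6 (ii)) is NOT ported: it is assembled in kernel from miracle flatness (tree, EGA IV 6.1.5),
Kollár's unramified coordinates (tree), flat + unramified ⇒ étale (tree, EGA IV 17.6.1) and Mathlib's
`Algebra.IsEtaleAt.exists_isStandardEtale` (Stacks 00UE) + `StandardEtalePresentation`.

THIS FILE: §VI.4 (first half) the étale local structure of an adapted regular chart: `residueField_centre_surjective`,
`flat_centre_of_regularParameters` (miracle flatness), `formallyUnramified_centre_of_regularParameters`,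
`exists_isStandardEtale_of_regularParameters`.
-/

noncomputable section

open IsLocalRing Literature.AlgebraicGeometry.Resolution
open Summit.ResolutionOfSingularities.ResolutionOfSingularities.Theorems
open Summit.ResolutionOfSingularities.ResolutionOfSingularities.Theorems.KeyChainLU
open Summit.ResolutionOfSingularities.ResolutionOfSingularities.Theorems.HenselKeyChainLU

namespace Summit.ResolutionOfSingularities.ResolutionOfSingularities.Theorems.AdaptedChartHensel

section AdaptedChart

open Polynomial

variable {k : Type} [Field k] {K : Type} [Field K] [Algebra k K]

/-! ### VI.4 (K-H): a value-adapted regular chart with residue field `k` lies in the Hensel cell -/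

set_option maxHeartbeats 400000 in
/-- If `O` is residually rational over `k` (`∀ y ∈ O, ∃ c ∈ k, v (y - c) < 1`) and the
`k`-subalgebra `A ⊆ O`, then `k` maps ONTO the residue field of the local ring of `A` at the
centre of `O`. [folklore] -/
theorem residueField_centre_surjective (O : ValuationSubring K) (A : Subalgebra k K)
    (hAO : A.toSubring ≤ O.toSubring)
    (hκ : ∀ y ∈ O, ∃ c : k, y - algebraMap k K c ∈ O.nonunits) :
    Function.Surjective
      (algebraMap k (ResidueField (Localization.AtPrime (centreIdeal A O hAO)))) := by
  have hAO' : ∀ a : A, (a : K) ∈ O := fun a => hAO a.2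
  have hkR : ∀ c : k, algebraMap k (Localization.AtPrime (centreIdeal A O hAO)) c =
      algebraMap A (Localization.AtPrime (centreIdeal A O hAO)) (algebraMap k A c) :=
    fun c => IsScalarTower.algebraMap_apply k A _ c
  have hkres : ∀ c : k,
      algebraMap k (ResidueField (Localization.AtPrime (centreIdeal A O hAO))) c =
        IsLocalRing.residue (Localization.AtPrime (centreIdeal A O hAO))
          (algebraMap A (Localization.AtPrime (centreIdeal A O hAO)) (algebraMap k A c)) :=
    fun c => by
    rw [← hkR c]
    exact IsScalarTower.algebraMap_apply k (Localization.AtPrime (centreIdeal A O hAO))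
      (ResidueField (Localization.AtPrime (centreIdeal A O hAO))) c
  have hresA : ∀ a : A, ∃ c : k,
      IsLocalRing.residue (Localization.AtPrime (centreIdeal A O hAO))
          (algebraMap A (Localization.AtPrime (centreIdeal A O hAO)) a) =
        algebraMap k (ResidueField (Localization.AtPrime (centreIdeal A O hAO))) c := by
    intro a
    obtain ⟨c, hc⟩ := hκ (a : K) (hAO' a)
    refine ⟨c, ?_⟩
    rw [hkres c]
    refine Ideal.Quotient.eq.mpr ?_
    rw [← map_sub]
    refine (IsLocalization.AtPrime.to_map_mem_maximal_iff (Localization.AtPrime (centreIdeal A O hAO))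
      (centreIdeal A O hAO) _).mpr ((KeyChainLU.mem_centreIdeal_iff A hAO _).mpr ?_)
    have hc' := (O.mem_nonunits_iff).mp hc
    simpa using hc'
  intro z
  obtain ⟨x, rfl⟩ := IsLocalRing.residue_surjective z
  obtain ⟨⟨a, s⟩, hx⟩ := IsLocalization.surj (centreIdeal A O hAO).primeCompl x
  obtain ⟨ca, hca⟩ := hresA a
  obtain ⟨cs, hcs⟩ := hresA s
  refine ⟨ca / cs, ?_⟩
  have hs : IsLocalRing.residue (Localization.AtPrime (centreIdeal A O hAO))
      (algebraMap A (Localization.AtPrime (centreIdeal A O hAO)) s) ≠ 0 := by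
    rw [Ne, IsLocalRing.residue_eq_zero_iff]
    exact fun h => s.2 ((IsLocalization.AtPrime.to_map_mem_maximal_iff
      (Localization.AtPrime (centreIdeal A O hAO)) (centreIdeal A O hAO) _).mp h)
  have hmul : IsLocalRing.residue (Localization.AtPrime (centreIdeal A O hAO)) x *
      IsLocalRing.residue (Localization.AtPrime (centreIdeal A O hAO))
        (algebraMap A (Localization.AtPrime (centreIdeal A O hAO)) s) =
      IsLocalRing.residue (Localization.AtPrime (centreIdeal A O hAO))
        (algebraMap A (Localization.AtPrime (centreIdeal A O hAO)) a) := by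
    rw [← map_mul, hx]
  rw [map_div₀, ← hca, ← hcs, div_eq_iff hs, hmul]

/-- The structure map `k[X₀..X₃] → A` of a chart with `Xᵢ ↦ uᵢ` is `MvPolynomial.aeval u`. [folklore] -/
theorem algebraMap_mvPolynomial_eq_aeval (A : Subalgebra k K) [Algebra (MvPolynomial (Fin 4) k) A]
    [IsScalarTower k (MvPolynomial (Fin 4) k) A] (u' : Fin 4 → A)
    (hX : ∀ i, algebraMap (MvPolynomial (Fin 4) k) A (MvPolynomial.X i) = u' i)
    (q : MvPolynomial (Fin 4) k) :
    algebraMap (MvPolynomial (Fin 4) k) A q = MvPolynomial.aeval u' q := by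
  have hφ : IsScalarTower.toAlgHom k (MvPolynomial (Fin 4) k) A = MvPolynomial.aeval u' :=
    MvPolynomial.algHom_ext fun i => by rw [IsScalarTower.toAlgHom_apply, hX, MvPolynomial.aeval_X]
  rw [← IsScalarTower.toAlgHom_apply k, hφ]

/-- **Miracle flatness at the centre.**  If the local ring `A_𝔮` of the chart at the centre `𝔮` of
`O` is regular of dimension `4` with maximal ideal generated by the images `u₀, …, u₃` of the
variables, then `A_𝔮` is flat over `k[X]_𝔭`, `𝔭 = 𝔮 ∩ k[X]`: the fibre `A_𝔮 / 𝔭A_𝔮 = A_𝔮 / 𝔪` is a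
field (regular of dimension `0`) and `dim k[X]_𝔭 + 0 ≤ 4 = dim A_𝔮`, so EGA IV 6.1.5
(`Literature.RingTheory.Flat.flat_of_isRegularLocalRing_of_isRegularLocalRing_fiber`) applies.
[Grothendieck1965, Prop. 6.1.5] [folklore] -/
theorem flat_centre_of_regularParameters (O : ValuationSubring K) (A : Subalgebra k K)
    (hAO : A.toSubring ≤ O.toSubring) [Algebra (MvPolynomial (Fin 4) k) A]
    [IsScalarTower k (MvPolynomial (Fin 4) k) A] [IsNoetherianRing A] (u' : Fin 4 → A)
    (hX : ∀ i, algebraMap (MvPolynomial (Fin 4) k) A (MvPolynomial.X i) = u' i)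
    [IsRegularLocalRing (Localization.AtPrime (centreIdeal A O hAO))]
    (hdim : ringKrullDim (Localization.AtPrime (centreIdeal A O hAO)) = 4)
    (hmax : maximalIdeal (Localization.AtPrime (centreIdeal A O hAO)) =
      Ideal.span (Set.range fun i =>
        algebraMap A (Localization.AtPrime (centreIdeal A O hAO)) (u' i))) :
    letI := Localization.AtPrime.algebraOfLiesOver
      ((centreIdeal A O hAO).under (MvPolynomial (Fin 4) k)) (centreIdeal A O hAO)
    Module.Flat (Localization.AtPrime ((centreIdeal A O hAO).under (MvPolynomial (Fin 4) k)))
      (Localization.AtPrime (centreIdeal A O hAO)) := by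
  set 𝔔 : Ideal A := centreIdeal A O hAO with h𝔔def
  let P := MvPolynomial (Fin 4) k
  let 𝔭 : Ideal P := 𝔔.under P
  let R𝔔 := Localization.AtPrime 𝔔
  let P𝔭 := Localization.AtPrime 𝔭
  letI := Localization.AtPrime.algebraOfLiesOver 𝔭 𝔔
  have hu𝔔 : ∀ i, u' i ∈ 𝔔 := by
    intro i
    have : algebraMap A R𝔔 (u' i) ∈ maximalIdeal R𝔔 := by
      rw [hmax]
      exact Ideal.subset_span ⟨i, rfl⟩
    exact (IsLocalization.AtPrime.to_map_mem_maximal_iff R𝔔 𝔔 (u' i)).mp this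
  have hX𝔭 : ∀ i, (MvPolynomial.X i : P) ∈ 𝔭 := by
    intro i
    change algebraMap P A (MvPolynomial.X i) ∈ 𝔔
    rw [hX]
    exact hu𝔔 i
  have hfib : (maximalIdeal P𝔭).map (algebraMap P𝔭 R𝔔) = maximalIdeal R𝔔 := by
    rw [← IsLocalization.AtPrime.map_eq_maximalIdeal 𝔭 P𝔭, Ideal.map_map,
      ← IsScalarTower.algebraMap_eq P P𝔭 R𝔔, IsScalarTower.algebraMap_eq P A R𝔔, ← Ideal.map_map]
    apply le_antisymm
    · rw [← IsLocalization.AtPrime.map_eq_maximalIdeal 𝔔 R𝔔]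
      exact Ideal.map_mono Ideal.map_comap_le
    · rw [hmax]
      refine Ideal.span_le.mpr ?_
      rintro _ ⟨i, rfl⟩
      refine Ideal.mem_map_of_mem _ ?_
      have := Ideal.mem_map_of_mem (algebraMap P A) (hX𝔭 i)
      rwa [hX] at this
  have hfield : IsField (R𝔔 ⧸ (maximalIdeal P𝔭).map (algebraMap P𝔭 R𝔔)) := by
    rw [hfib]
    exact (Ideal.Quotient.maximal_ideal_iff_isField_quotient _).mp inferInstance
  have hF : IsRegularLocalRing (R𝔔 ⧸ (maximalIdeal P𝔭).map (algebraMap P𝔭 R𝔔)) :=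
    isRegularLocalRing_of_isField hfield
  have hdimP : ringKrullDim P𝔭 ≤ 4 := by
    rw [IsLocalization.AtPrime.ringKrullDim_eq_height 𝔭 P𝔭]
    have h := Ideal.height_le_ringKrullDim_of_isPrime (I := 𝔭)
    have hP4 : ringKrullDim P = 4 := by
      rw [MvPolynomial.ringKrullDim_of_isNoetherianRing, ringKrullDim_eq_zero_of_field]
      simp
    rwa [hP4] at h
  have hdim0 : ringKrullDim (R𝔔 ⧸ (maximalIdeal P𝔭).map (algebraMap P𝔭 R𝔔)) = 0 := by
    have h0 := ringKrullDim_eq_zero_of_isField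
      (F := R𝔔 ⧸ (maximalIdeal P𝔭).map (algebraMap P𝔭 R𝔔)) hfield
    convert h0
  exact Literature.RingTheory.Flat.flat_of_isRegularLocalRing_of_isRegularLocalRing_fiber hF
    (by rw [hdim0, add_zero, hdim]; exact hdimP)

/-- **Unramified coordinates at a `k`-rational regular centre.**  If `O` is residually rational
over `k`, `A ⊆ O`, and the maximal ideal of `A_𝔮` is generated by `u₀, …, u₃`, then `A_𝔮` is
formally unramified over `k[X₀..X₃]` (`Xᵢ ↦ uᵢ`): the residue field of `A_𝔮` is `k`
(`residueField_centre_surjective`), hence separable over `k`, and `Ω_{A_𝔮/k}` is generated by the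
`duᵢ` (`formallyUnramified_mvPolynomial_of_span_eq_maximalIdeal`). [Kollar2007, proof of 3.69]
[folklore] -/
theorem formallyUnramified_centre_of_regularParameters (O : ValuationSubring K)
    (A : Subalgebra k K) (hAO : A.toSubring ≤ O.toSubring) [Algebra (MvPolynomial (Fin 4) k) A]
    [IsScalarTower k (MvPolynomial (Fin 4) k) A] [Algebra.FiniteType k A] (u' : Fin 4 → A)
    (hX : ∀ i, algebraMap (MvPolynomial (Fin 4) k) A (MvPolynomial.X i) = u' i)
    (hκ : ∀ y ∈ O, ∃ c : k, y - algebraMap k K c ∈ O.nonunits)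
    (hmax : maximalIdeal (Localization.AtPrime (centreIdeal A O hAO)) =
      Ideal.span (Set.range fun i =>
        algebraMap A (Localization.AtPrime (centreIdeal A O hAO)) (u' i))) :
    Algebra.FormallyUnramified (MvPolynomial (Fin 4) k)
      (Localization.AtPrime (centreIdeal A O hAO)) := by
  set 𝔔 : Ideal A := centreIdeal A O hAO with h𝔔def
  let P := MvPolynomial (Fin 4) k
  let R𝔔 := Localization.AtPrime 𝔔
  haveI : Algebra.EssFiniteType k R𝔔 := Algebra.EssFiniteType.comp k A R𝔔
  have hsurj : Function.Surjective (algebraMap k (ResidueField R𝔔)) :=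
    residueField_centre_surjective O A hAO hκ
  haveI : Algebra.IsSeparable k (ResidueField R𝔔) :=
    ⟨fun z => by
      obtain ⟨c, rfl⟩ := hsurj z
      exact isSeparable_algebraMap c⟩
  have hx : Ideal.span (Set.range fun i => algebraMap A R𝔔 (u' i)) = maximalIdeal R𝔔 := hmax.symm
  have haev : ∀ q : P, MvPolynomial.aeval (fun i => algebraMap A R𝔔 (u' i)) q =
      algebraMap P R𝔔 q := by
    intro q
    rw [IsScalarTower.algebraMap_apply P A R𝔔, algebraMap_mvPolynomial_eq_aeval A u' hX]
    change _ = (IsScalarTower.toAlgHom k A R𝔔) (MvPolynomial.aeval u' q)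
    rw [← AlgHom.comp_apply, MvPolynomial.comp_aeval]
    rfl
  have h := formallyUnramified_mvPolynomial_of_span_eq_maximalIdeal (k := k) (A := R𝔔)
    (fun i => algebraMap A R𝔔 (u' i)) hx
  have hinst : (MvPolynomial.aeval fun i => algebraMap A R𝔔 (u' i)).toRingHom.toAlgebra =
      (inferInstance : Algebra P R𝔔) :=
    Algebra.algebra_ext _ _ fun q => by
      rw [RingHom.algebraMap_toAlgebra]
      exact haev q
  rw [hinst] at h
  exact h

/-- **Étale local structure of a regular chart with prescribed parameters** (EGA IV 18.4.6 (ii),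
17.6.1; Milne, *Étale cohomology* I 3.14, in kernel).  Under the hypotheses of the two previous
lemmas and `A` of finite type over `k`: `A` is étale over `P = k[X₀..X₃]` at the centre `𝔮`
(`isEtaleAt_of_flat_of_formallyUnramified_localization`), hence some `A[1/r]`, `r ∉ 𝔮`, is
STANDARD ÉTALE over `P` (Mathlib `Algebra.IsEtaleAt.exists_isStandardEtale`, Stacks 00UE); and
`P → A` is injective (faithful flatness of `P_𝔭 → A_𝔮`), i.e. `u₀, …, u₃` are algebraically
independent. [Grothendieck1967, Thm. 17.6.1 and Prop. 18.4.6 (ii)] [folklore] -/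
theorem exists_isStandardEtale_of_regularParameters (O : ValuationSubring K)
    (A : Subalgebra k K) (hAO : A.toSubring ≤ O.toSubring) [Algebra (MvPolynomial (Fin 4) k) A]
    [IsScalarTower k (MvPolynomial (Fin 4) k) A] (u' : Fin 4 → A)
    (hX : ∀ i, algebraMap (MvPolynomial (Fin 4) k) A (MvPolynomial.X i) = u' i) (hAfg : A.FG)
    (hκ : ∀ y ∈ O, ∃ c : k, y - algebraMap k K c ∈ O.nonunits)
    (hreg : IsRegularLocalRing (Localization.AtPrime (centreIdeal A O hAO)))
    (hdim : ringKrullDim (Localization.AtPrime (centreIdeal A O hAO)) = 4)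
    (hmax : maximalIdeal (Localization.AtPrime (centreIdeal A O hAO)) =
      Ideal.span (Set.range fun i =>
        algebraMap A (Localization.AtPrime (centreIdeal A O hAO)) (u' i))) :
    Function.Injective (algebraMap (MvPolynomial (Fin 4) k) A) ∧
      ∃ r : A, r ∉ centreIdeal A O hAO ∧
        Algebra.IsStandardEtale (MvPolynomial (Fin 4) k) (Localization.Away r) := by
  set 𝔔 : Ideal A := centreIdeal A O hAO with h𝔔def
  let P := MvPolynomial (Fin 4) k
  haveI hFT : Algebra.FiniteType k A := (Subalgebra.fg_iff_finiteType A).mp hAfg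
  haveI : IsNoetherianRing A := Algebra.FiniteType.isNoetherianRing k A
  haveI : Algebra.FiniteType P A := Algebra.FiniteType.of_restrictScalars_finiteType k P A
  haveI : Algebra.FinitePresentation P A :=
    (Algebra.FinitePresentation.of_finiteType).mp inferInstance
  let 𝔭 : Ideal P := 𝔔.under P
  let R𝔔 := Localization.AtPrime 𝔔
  let P𝔭 := Localization.AtPrime 𝔭
  letI := Localization.AtPrime.algebraOfLiesOver 𝔭 𝔔
  haveI := hreg
  have hflat : Module.Flat P𝔭 R𝔔 := flat_centre_of_regularParameters O A hAO u' hX hdim hmax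
  have hurP : Algebra.FormallyUnramified P R𝔔 :=
    formallyUnramified_centre_of_regularParameters O A hAO u' hX hκ hmax
  have hur : Algebra.FormallyUnramified P𝔭 R𝔔 :=
    Algebra.FormallyUnramified.of_restrictScalars P P𝔭 R𝔔
  haveI hEt : Algebra.IsEtaleAt P 𝔔 :=
    isEtaleAt_of_flat_of_formallyUnramified_localization 𝔭 𝔔 hflat hur
  refine ⟨?_, Algebra.IsEtaleAt.exists_isStandardEtale (R := P) 𝔔⟩
  haveI : Module.Flat P𝔭 R𝔔 := hflat
  haveI : Module.FaithfullyFlat P𝔭 R𝔔 := Module.FaithfullyFlat.of_flat_of_isLocalHom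
  have h1 : Function.Injective (algebraMap P𝔭 R𝔔) := FaithfulSMul.algebraMap_injective P𝔭 R𝔔
  have h2 : Function.Injective (algebraMap P P𝔭) :=
    IsLocalization.injective P𝔭 𝔭.primeCompl_le_nonZeroDivisors
  have h3 : Function.Injective (algebraMap P R𝔔) := by
    rw [IsScalarTower.algebraMap_eq P P𝔭 R𝔔, RingHom.coe_comp]
    exact h1.comp h2
  rw [IsScalarTower.algebraMap_eq P A R𝔔, RingHom.coe_comp] at h3
  exact h3.of_comp

end AdaptedChart

end Summit.ResolutionOfSingularities.ResolutionOfSingularities.Theorems.AdaptedChartHensel
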